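import Literature.NumberTheory.EllipticCurves.ArtinMilneShaDecomposition
import Literature.NumberTheory.EllipticCurves.Disegni2020.PAdicBSDRankOneMultiplicativeProofs
import Literature.NumberTheory.EllipticCurves.AnalyticRankModularityProofs
import Summits.BirchSwinnertonDyer.Rank1Residual.X1.RankZeroPartner
import Summits.BirchSwinnertonDyer.Rank1Residual.WAll.TargetAdditiveAtThreeCells
import Literature.NumberTheory.EllipticCurves.QuadraticTwist
import HarnessLib

/-!
# Route `TameQuarticSolvent`, crux `SolventPairLowerBound` (stmt-BirchSwinnertonDyer-21391), line `birth` —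
# the BOOKKEEPING GLUE for stub `stub_pairGivenGoodField`: the pair inequality from a "solvent package"
# (exact `BSD₃(E/M)` over the quartic `M = K(√β)`, the upper bound for `E′ = E_K^{(β)}`, in the D2 currency)

HONEST FRAMING. Theorems only; helper towards the registered stub `stub_pairGivenGoodField` of the birth
skeleton (`--supports stmt-BirchSwinnertonDyer-21391`, width seat `bsd-wall-tqs-p1-w2`). Nothing here is
progress on BSD: the load-bearing inputs — K1 = exact `BSD₃` of `E` over the tame quartic solvent field (OPEN,
conjecture-level) and K2(a) = an Euler-system UPPER bound for the twisted constituent `E′ = E_K^{(β)}` over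
`K = ℚ(√d)` — enter as HYPOTHESES, packaged exactly in the currency of the tree's D2 theorem
`Literature.NumberTheory.EllipticCurves.padicValRat_shaAn_add_le_shaOrder_of_bsdpOver` (Dokchitser–Dokchitser /
Milne bookkeeping). What this file DOES is discharge every `ℚ`-side input of that theorem from named facts
already in the tree, so that the crux's remaining content is displayed as ONE existential package per
admissible twist pair. BSD is not proved by any of this; no route file is imported.

WHAT.
* `exists_rat_shaAn_eq_of_analyticRank_eq_zero` — `#Ш_an(E) ∈ ℚ` in analytic rank `0` (modular symbols:
  `L(E,1)/Ω_E ∈ ℚ`, tree `X1.RankZeroPartner.exists_rat_entireLFunction_one_div_realPeriodRat`; regulator `1`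
  by Gross–Zagier–Kolyvagin).
* `padicValRat_shaAn_pair_le_of_solventPackage` — for globally minimal `W` (`r_an = 1`) and `Wd` (`r_an = 0`)
  and a SOLVENT PACKAGE (a quadratic field `K` with `Wd ≅ W^{(d_K)}`, a quadratic extension `M = K(θ)`,
  `θ² = β`, models `Vβ ≅ (W_K)^{(β)}`, `VM ≅ W_M`, EXACT `BSD₃(VM/M)` [K1], and for `Vβ`: entire `L`-function,
  `#Ш_an ∈ ℚ`, `Ш[3^∞]` finite with `ord₃ #Ш[3^∞] ≤ ord₃ #Ш_an` [K2(a)]):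
  `ord₃ #Ш_an(W) + ord₃ #Ш_an(Wd) ≤ ord₃ #Ш(W) + ord₃ #Ш(Wd)` — GIVEN the named facts `ArtinMilneShaDecomposition`
  (Milne 1972 / Dokchitser–Dokchitser 2010), modularity (`exists_isNewformOf`, `nonempty_modularParametrizationData`),
  Gross–Zagier Thm. I.(7.3) (`GrossZagier1986_thm_I_7_3`) and Gross–Zagier–Kolyvagin
  (`rank_eq_analyticRank_of_analyticRank_le_one`): these give `Ш(W)`, `Ш(Wd)` finite, `#Ш_an(W)`, `#Ш_an(Wd)`
  rational, `L(W, s)`, `L(Wd, s)` entire — the `ℚ`-side hypotheses of the D2 squeeze.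
* `stub_pairGivenGoodField_of_solventPackage` — the registered stub's statement VERBATIM, from the named facts
  and ONE hypothesis `hSolv`: every admissible pair `(W, d, Wd)` of the stub (with the LEVER `hgood`: good
  reduction of `W` at every place of ramification index `4` over `3`) admits a solvent package. This is the
  shape in which the planner can split the stub: SolventField (∃ K, M, β — sibling seat w3's rungs) ·
  ExactBSD3OverSolvent (K1) · KolyvaginTwistedUpper (K2a) ⟹ `hSolv`.
* (companion files) the same with the package SPLIT into a field supply, a K1 hypothesis and a K2a hypothesis
  over one explicit predicate `IsSolventFieldDatum` (route-posited object, `TameQuarticSolventDefs.lean`).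

PARITY REMARK (design note for K2a, not used in the proofs). By Artin formalism for root numbers,
`w(E′/K) = w(E/M) · w(E) · w(E^{(d)}) = −w(E/M)`, and `w(E/M) = ∏_{v ∣ N′} w_v(E/M_v)` (`M` totally real of
degree `4`, `E` good above `3`). So `r_an(E′/K) = 0` requires an ODD number of places `v ∣ N′ = N/9` of `M`
with `w_v = −1` — available when `E` has a multiplicative prime `ℓ ≠ 3` (`ℓ = 𝔮𝔮′` in `K`, `β` a square at
`𝔮` and a non-square unit at `𝔮′`), not when every `ℓ ∣ N′` is additive and unramified in `M`; the theorems
below are therefore AGNOSTIC about the rank of `E′` (K2(a) is an upper bound `ord₃ #Ш(E′)[3^∞] ≤ ord₃ #Ш_an(E′)`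
in any rank).

References: T. Dokchitser, V. Dokchitser, Ann. of Math. 172 (2010) Thm. 2.3; J. S. Milne, Invent. Math. 17
(1972) Thm. 1; R. L. Miller, LMS J. Comput. Math. 14 (2011) Def. 1.1; B. Gross, D. Zagier, Invent. Math. 84
(1986) Thm. I.(7.3); V. A. Kolyvagin (1990); C. Breuil, B. Conrad, F. Diamond, R. Taylor, JAMS 14 (2001) Thm. A.
-/

-- D-0017: single-problem summit, so `Summit.BirchSwinnertonDyer.BirchSwinnertonDyer.…` repeats a namespace BY DESIGN.
set_option linter.dupNamespace false

noncomputable section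

open scoped Classical NumberField

open IsDedekindDomain NumberField WeierstrassCurve
open Literature.NumberTheory.EllipticCurves
open Literature.NumberTheory.EllipticCurves.ModularForms
open Literature.NumberTheory.EllipticCurves.Rank1Residual
open Summit.BirchSwinnertonDyer.Rank1Residual.Additive

namespace Summit.BirchSwinnertonDyer.BirchSwinnertonDyer.Theorems.SolventPairLowerBound

/-! ## §1 `ℚ`-side inputs of the D2 squeeze -/

/-- **`#Ш_an(E) ∈ ℚ` in analytic rank zero.** For a globally minimal elliptic `W/ℚ` with
`ord_{s=1} L(W, s) = 0`: `#Ш_an(W) = (L(W,1)/Ω_W) · #W(ℚ)_tors² / ∏ c_ℓ` with `L(W,1)/Ω_W ∈ ℚ` (modular symbols,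
tree `X1.RankZeroPartner.exists_rat_entireLFunction_one_div_realPeriodRat`, from the modular parametrisation
`nonempty_modularParametrizationData`) and `Reg(W) = 1` (rank `0` by Gross–Zagier–Kolyvagin).
[cite: Miller2011LMS, §1 and Def. 1.1 (arXiv:1010.2431 p. 3)] [cite: Darmon2004, Thm. 3.22 (= Thm. 1.14)] -/
theorem exists_rat_shaAn_eq_of_analyticRank_eq_zero (hmodP : nonempty_modularParametrizationData)
    (hGZK : rank_eq_analyticRank_of_analyticRank_le_one) (W : WeierstrassCurve ℚ) [W.IsElliptic]
    [W.IsGloballyMinimal] (hr : W.analyticRank = 0) : ∃ s : ℚ, shaAn W = (s : ℂ) := by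
  obtain ⟨q, hq⟩ :=
    Summit.BirchSwinnertonDyer.Rank1Residual.X1.RankZeroPartner.exists_rat_entireLFunction_one_div_realPeriodRat
      hmodP W
  have hΩC : (W.realPeriodRat : ℂ) ≠ 0 := Complex.ofReal_ne_zero.mpr W.realPeriodRat_pos_holds.ne'
  have hL1 : W.entireLFunction 1 = (q : ℂ) * (W.realPeriodRat : ℂ) := by
    rw [← hq, div_mul_cancel₀ _ hΩC]
  obtain ⟨hrank, -⟩ := hGZK W (by omega)
  have hReg : W.regulator = 1 := W.regulator_eq_one_of_rank_zero (hrank.trans hr)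
  refine ⟨q * (W.torsionOrder : ℚ) ^ 2 / (W.tamagawaProduct : ℚ), ?_⟩
  rw [shaAn_def, W.leadingLCoeff_eq_of_analyticRank_eq_zero hr, hL1, hReg]
  have hcC : ((W.tamagawaProduct : ℚ) : ℂ) ≠ 0 := by exact_mod_cast W.tamagawaProduct_pos'.ne'
  push_cast
  field_simp

/-! ## §2 The pair inequality from a solvent package -/

/-- **The pair inequality of crux `SolventPairLowerBound` from a SOLVENT PACKAGE.** Let `W/ℚ` (globally
minimal, `r_an = 1`) and `Wd/ℚ` (globally minimal, `r_an = 0`) be given together with: a quadratic field `K`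
(`[K:ℚ] = 2`) with `Wd ≅ W^{(d_K)}`; a quadratic extension `M = K(θ)`, `θ² = β ∈ K`, `θ ∉ K`; models
`Vβ ≅ (W_K)^{(β)}` over `K` and `VM ≅ W_M` over `M`; **K1** exact `BSD₃(VM/M)` (`BSDpOver VM 3`); **K2(a)** for
`E′ = Vβ`: `L(E′/K, s)` entire, `#Ш_an(E′) = qβ ∈ ℚ`, `Ш(E′/K)[3^∞]` finite and
`ord₃ #Ш(E′/K)[3^∞] ≤ ord₃ qβ`. Then, GIVEN the named facts `ArtinMilneShaDecomposition`, modularity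
(`exists_isNewformOf`, `nonempty_modularParametrizationData`), Gross–Zagier Thm. I.(7.3) and
Gross–Zagier–Kolyvagin: `#Ш_an(W) = q`, `#Ш_an(Wd) = q′` are rational and
`ord₃ q + ord₃ q′ ≤ ord₃ #Ш(W) + ord₃ #Ш(Wd)`. Proof: the D2 squeeze
`padicValRat_shaAn_add_le_shaOrder_of_bsdpOver`, with `Ш(W)`, `Ш(Wd)` finite (GZK), `L(W,s)`, `L(Wd,s)` entire
(modularity), `#Ш_an(W) ∈ ℚ` (Gross–Zagier, rank one) and `#Ш_an(Wd) ∈ ℚ` (§1, rank zero).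
[cite: DokchitserDokchitserAnnals2010, §2.1 Thm. 2.3 (second clause) and its proof]
[cite: Miller2011LMS, §1 and Def. 1.1 (arXiv:1010.2431 p. 3)] [cite: GrossZagier1986, Thm. I.(7.3) 2) (p. 231)]
[cite: Darmon2004, Thm. 3.22 (= Thm. 1.14)] -/
theorem padicValRat_shaAn_pair_le_of_solventPackage (hAM : ArtinMilneShaDecomposition)
    (hmod : exists_isNewformOf) (hmodP : nonempty_modularParametrizationData)
    (hGZ : GrossZagier1986_thm_I_7_3) (hGZK : rank_eq_analyticRank_of_analyticRank_le_one)
    (W : WeierstrassCurve ℚ) [W.IsElliptic] [W.IsGloballyMinimal] (hrW : W.analyticRank = 1)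
    (Wd : WeierstrassCurve ℚ) [Wd.IsElliptic] [Wd.IsGloballyMinimal] (hrWd : Wd.analyticRank = 0)
    (K : Type) [Field K] [NumberField K] (h2 : Module.finrank ℚ K = 2)
    (hWd : ∃ C : WeierstrassCurve.VariableChange ℚ, C • W.quadraticTwist (NumberField.discr K : ℚ) = Wd)
    (M : Type) [Field M] [NumberField M] [Algebra K M] (h2' : Module.finrank K M = 2)
    {β : K} {θ : M} (hθ : θ ^ 2 = algebraMap K M β) (hθK : θ ∉ Set.range (algebraMap K M))
    (Vβ : WeierstrassCurve K) [Vβ.IsElliptic]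
    (hVβ : ∃ C : WeierstrassCurve.VariableChange K, C • (W.baseChange K).quadraticTwist β = Vβ)
    (VM : WeierstrassCurve M) [VM.IsElliptic]
    (hVM : ∃ C : WeierstrassCurve.VariableChange M, C • W.baseChange M = VM)
    (hK1 : BSDpOver VM 3) (hVβL : Vβ.HasEntireLFunction)
    (hK2a : ∃ qβ : ℚ, analyticSha Vβ = (qβ : ℂ) ∧ Finite (AddCommGroup.primaryComponent Vβ.sha 3) ∧
      (padicValNat 3 (Nat.card (AddCommGroup.primaryComponent Vβ.sha 3)) : ℤ) ≤ padicValRat 3 qβ) :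
    ∃ q q' : ℚ, shaAn W = (q : ℂ) ∧ shaAn Wd = (q' : ℂ) ∧
      padicValRat 3 q + padicValRat 3 q' ≤ (padicValNat 3 W.shaOrder : ℤ) + (padicValNat 3 Wd.shaOrder : ℤ) := by
  obtain ⟨qW, hqW⟩ := Disegni2020.exists_rat_shaAn_eq_of_analyticRank_eq_one hGZ hGZK W hrW
  obtain ⟨qWd, hqWd⟩ := exists_rat_shaAn_eq_of_analyticRank_eq_zero hmodP hGZK Wd hrWd
  obtain ⟨qβ, hqβ, hβfin, hβup⟩ := hK2a
  have hWfin : W.ShaFinite := (hGZK W (by omega)).2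
  have hWdfin : Wd.ShaFinite := (hGZK Wd (by omega)).2
  have hWL : W.HasEntireLFunction := hasEntireLFunction_rat_of_exists_isNewformOf hmod W
  have hWdL : Wd.HasEntireLFunction := hasEntireLFunction_rat_of_exists_isNewformOf hmod Wd
  exact ⟨qW, qWd, hqW, hqWd, padicValRat_shaAn_add_le_shaOrder_of_bsdpOver hAM W K h2 Wd hWd M h2' hθ hθK Vβ
    hVβ VM hVM 3 hWfin hWdfin hWL hWdL hVβL hK1 hqβ hβfin hβup hqW hqWd⟩

/-! ## §3 The registered stub from ONE existential hypothesis -/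

/-- **Stub `stub_pairGivenGoodField` of the birth skeleton from a SOLVENT-PACKAGE SUPPLY.** GIVEN the named
facts of §2 and the single hypothesis `hSolv` — every admissible datum of the stub (`W` non-CM, globally
minimal, additive of class (t′) at `3`, `r_an = 1`, with the LEVER `hgood`: good reduction at every place of
ramification index `4` over `3` of every number field; `d > 0`, `ord₃ d = 1`, `Wd ≅ W^{(d)}` globally minimal,
non-CM, (t′) at `3`, `r_an = 0`) admits a solvent package in the sense of
`padicValRat_shaAn_pair_le_of_solventPackage` (field `K` with `Wd ≅ W^{(d_K)}`, quadratic `M = K(θ)`,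
`θ² = β`, models, K1 = `BSDpOver VM 3`, K2(a) for `Vβ`) — the registered stub statement holds VERBATIM.
This is the bookkeeping P3 of the route thesis (Artin–Milne: `L(E/M,s) = L(E,s) L(E^{(d)},s) L(E′/K,s)`,
`δ₃(E/M) = δ₃(E) + δ₃(E^{(d)}) + δ₃(E′)`, squeezed one-sidedly). [cite: Milne1972ArithmeticAV, §1 Thm. 1]
[cite: DokchitserDokchitserAnnals2010, §2.1 Thm. 2.3 and §4.2] -/
theorem stub_pairGivenGoodField_of_solventPackage (hAM : ArtinMilneShaDecomposition)
    (hmod : exists_isNewformOf) (hmodP : nonempty_modularParametrizationData)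
    (hGZ : GrossZagier1986_thm_I_7_3) (hGZK : rank_eq_analyticRank_of_analyticRank_le_one)
    (hSolv : ∀ (W : WeierstrassCurve ℚ) [W.IsElliptic] [W.IsGloballyMinimal],
      ¬ W.HasCM → Addv W 3 → SubTprime W 3 → W.analyticRank = 1 →
      (∀ (L : Type) [Field L] [NumberField L] (v : HeightOneSpectrum (𝓞 L)),
        ((3 : ℕ) : 𝓞 L) ∈ v.asIdeal → v.asIdeal.ramificationIdx ℤ = 4 → (W.baseChange L).HasGoodReductionAt v) →
      ∀ (d : ℤ) (Wd : WeierstrassCurve ℚ) [Wd.IsElliptic] [Wd.IsGloballyMinimal],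
        0 < d → padicValInt 3 d = 1 →
        (∃ C : WeierstrassCurve.VariableChange ℚ, C • W.quadraticTwist (d : ℚ) = Wd) →
        ¬ Wd.HasCM → Addv Wd 3 → SubTprime Wd 3 → Wd.analyticRank = 0 →
        ∃ (K : Type) (_ : Field K) (_ : NumberField K) (M : Type) (_ : Field M) (_ : NumberField M)
          (_ : Algebra K M) (β : K) (θ : M) (Vβ : WeierstrassCurve K) (_ : Vβ.IsElliptic)
          (VM : WeierstrassCurve M) (_ : VM.IsElliptic),
          Module.finrank ℚ K = 2 ∧
          (∃ C : WeierstrassCurve.VariableChange ℚ, C • W.quadraticTwist (NumberField.discr K : ℚ) = Wd) ∧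
          Module.finrank K M = 2 ∧ θ ^ 2 = algebraMap K M β ∧ θ ∉ Set.range (algebraMap K M) ∧
          (∃ C : WeierstrassCurve.VariableChange K, C • (W.baseChange K).quadraticTwist β = Vβ) ∧
          (∃ C : WeierstrassCurve.VariableChange M, C • W.baseChange M = VM) ∧
          BSDpOver VM 3 ∧ Vβ.HasEntireLFunction ∧
          (∃ qβ : ℚ, analyticSha Vβ = (qβ : ℂ) ∧ Finite (AddCommGroup.primaryComponent Vβ.sha 3) ∧
            (padicValNat 3 (Nat.card (AddCommGroup.primaryComponent Vβ.sha 3)) : ℤ) ≤ padicValRat 3 qβ)) :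
    ∀ (W : WeierstrassCurve ℚ) [W.IsElliptic] [W.IsGloballyMinimal],
    ¬ W.HasCM → Addv W 3 → Summit.BirchSwinnertonDyer.Rank1Residual.Additive.SubTprime W 3 → W.analyticRank = 1 →
    (∀ (L : Type) [Field L] [NumberField L] (v : HeightOneSpectrum (𝓞 L)),
      ((3 : ℕ) : 𝓞 L) ∈ v.asIdeal → v.asIdeal.ramificationIdx ℤ = 4 →
      (W.baseChange L).HasGoodReductionAt v) →
    ∀ (d : ℤ) (Wd : WeierstrassCurve ℚ) [Wd.IsElliptic] [Wd.IsGloballyMinimal],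
      0 < d → padicValInt 3 d = 1 →
      (∃ C : WeierstrassCurve.VariableChange ℚ, C • W.quadraticTwist (d : ℚ) = Wd) →
      ¬ Wd.HasCM → Addv Wd 3 → Summit.BirchSwinnertonDyer.Rank1Residual.Additive.SubTprime Wd 3 → Wd.analyticRank = 0 →
      ∃ q q' : ℚ, shaAn W = (q : ℂ) ∧ shaAn Wd = (q' : ℂ) ∧
        padicValRat 3 q + padicValRat 3 q' ≤
          (padicValNat 3 W.shaOrder : ℤ) + (padicValNat 3 Wd.shaOrder : ℤ) := by
  intro W _ _ hCM hadd hsub hr hgood d Wd _ _ hd hv htw hCMd haddd hsubd hr0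
  obtain ⟨K, _, _, M, _, _, _, β, θ, Vβ, _, VM, _, h2, hWd, h2', hθ, hθK, hVβ, hVM, hK1, hVβL, hK2a⟩ :=
    hSolv W hCM hadd hsub hr hgood d Wd hd hv htw hCMd haddd hsubd hr0
  exact padicValRat_shaAn_pair_le_of_solventPackage hAM hmod hmodP hGZ hGZK W hr Wd hr0 K h2 hWd M h2' hθ hθK
    Vβ hVβ VM hVM hK1 hVβL hK2a

end Summit.BirchSwinnertonDyer.BirchSwinnertonDyer.Theorems.SolventPairLowerBound

end
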